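import Summits.HodgeConjecture.HodgeConjecture.Theorems.Ring2AbelianAllAndreRelativeCorrespondences
import Literature.AlgebraicGeometry.HodgeTheory.CurveCorrespondencePushforward
import HarnessLib

/-!
# Ring 2 · sub-cell AbelianAll (ALL ABELIAN VARIETIES), André axis, part XVIII-g — the corner `(p,q) = (d,0)` of the
# "hom ≡ num" candidate (Num_t) is UNCONDITIONAL: the class of the zero SECTION detects the fibre class

HONEST FRAMING (page 1, verbatim): **research route, not a corollary; conditional on HC_CM plus one named
minimal statement.** Cell line: research route conditional on HC_CM; not a corollary; Q11.4-sentence-2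
already refuted in dim ≥ 3. Nothing in this file proves a case of the Hodge conjecture for an abelian variety.
Seat `pub-hodge-ring2-ab-andre-2`, gen 10 (companion of parts XVIII-a/c: (Num_t)(p,q) = "every `b ∈ N^q(𝒳_t)` with
`a ∪ j_{t*} b = 0` for all `a ∈ N^p(𝒳)` has `j_{t*} b = 0`", `p + q = d`; part XVIII-c proves the corner `(0, d)`).

## What is proved (theorems only; no definition, no named fact, no sorry)

* `isClosedImmersion_section_left` — a section `e` of the compact pencil `f` (`e ≫ f = 𝟙`) is a closed immersion
  (`f` is separated; Mathlib's cancellation `MorphismProperty.of_postcomp`).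
* `complexGysin_section_pointGysin_ne_zero` — `e_*[t] ≠ 0` in `H^{2d+2}(𝒳(ℂ); ℂ)`: `e_*(t_* 1) = (t ≫ e)_* 1` (Gysin
  functoriality) is the class of a POINT of the `(d+1)`-fold `𝒳`, non-zero (Wirtinger; the tree's
  `complexGysin_one_ne_zero_of_stalkMap_surjective`).
* **`cupProduct_sectionClass_fiberGysin_one_ne_zero` — `[e(S)] ∪ [𝒳_t] ≠ 0`**: `[𝒳_t] = f^* σ` with `σ ≠ 0` (part XVI-c),
  so `[𝒳_t] ∪ e_* 1 = e_*(e^* f^* σ ∪ 1) = e_* σ ≠ 0` (projection formula, `e ≫ f = 𝟙`).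
* **`numerical_top_zero'` — (Num_t)(d, 0) holds for every compact pencil of abelian varieties and every `t`**: `N⁰(𝒳_t) = ℂ·1`,
  `j_{t*}(c·1) = c·[𝒳_t]`, and the section class `e_* 1 ∈ N^d(𝒳)` has `e_* 1 ∪ [𝒳_t] ≠ 0`.

So for compact pencils of ELLIPTIC CURVES (`d = 1`) the candidate (Num_t) is a THEOREM in both bidegrees `(0,1)` (part XVIII-c)
and `(1,0)` (here) — consistent with the unconditional `d ≤ 1` rungs of the column (parts VI, XI).

References: FultonYoungTableaux1997 (App. B (2), (5), (6)); GriffithsHarrisPrinciples1978 (Ch. 0 §7); Fulton1998 (§19.1);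
Hartshorne1977 (II Ex. 4.8); Kleiman1968AlgebraicCycles (§3).
-/

noncomputable section

set_option linter.dupNamespace false

namespace Summit.HodgeConjecture.HodgeConjecture.Ring2.AbelianAll

open CategoryTheory AlgebraicGeometry
open Literature.AlgebraicGeometry Literature.AlgebraicGeometry.Motives
open Literature.AlgebraicGeometry.HodgeTheory
open Literature.AlgebraicTopology.SingularHomology (singularCohomology cupProduct cupProduct_gradedComm_holds cupProduct_one)
open Summit.HodgeConjecture.HodgeConjecture.Theses

variable {𝒳 S : SchemeOver ℂ}

/-- **A section of a compact pencil is a closed immersion** (`e ≫ f = 𝟙` with `f` separated — it is proper —;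
cancellation of closed immersions against separated morphisms). [cite: Hartshorne1977, II Ex. 4.8 and Cor. 4.8] -/
theorem isClosedImmersion_section_left {d : ℕ} {f : 𝒳 ⟶ S} (hf : IsCompactAbelianPencil f d) {e : S ⟶ 𝒳}
    (he : e ≫ f = 𝟙 S) : IsClosedImmersion e.left := by
  haveI : IsProper f.left := hf.isSmoothProjectiveFamily.isProper
  refine MorphismProperty.of_postcomp (W := @IsClosedImmersion) (W' := @IsSeparated) e.left f.left inferInstance ?_
  rw [show e.left ≫ f.left = (e ≫ f).left from rfl, he]
  change IsClosedImmersion (𝟙 S.left)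
  infer_instance

/-- **`e_*[t] ≠ 0` in `H^{2d+2}(𝒳(ℂ); ℂ)`** for a section `e` and a point `t` of the base: `e_*(t_* 1) = (t ≫ e)_* 1`, the class
of a point of the smooth projective `(d+1)`-fold `𝒳` (a closed immersion `Spec ℂ ⟶ 𝒳`), which is non-zero.
[cite: FultonYoungTableaux1997, Appendix B §B.1 (2) and (5)] [cite: GriffithsHarrisPrinciples1978, Ch. 0 §7 (pp. 109–111)] -/
theorem complexGysin_section_pointGysin_ne_zero {d : ℕ} {f : 𝒳 ⟶ S} (hf : IsCompactAbelianPencil f d) {e : S ⟶ 𝒳}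
    (he : e ≫ f = 𝟙 S) (t : ComplexPoints S) :
    complexGysin complexOrientationFamily hf.isSmoothProjective_base hf.isSmoothProjective_total e
        (show 2 * (0 + 1) + 2 * (d + 1) = 2 * (d + 1) + 2 * 1 by ring)
      (complexGysin complexOrientationFamily isSmoothProjective_specOver hf.isSmoothProjective_base t
        (show 0 + 2 * 1 = 2 * (0 + 1) + 2 * 0 by rfl) (singularCohomology.one ℂ (ComplexPoints (specOver ℂ ℂ)))) ≠ 0 := by
  have hS := hf.isSmoothProjective_base
  have h𝒳 := hf.isSmoothProjective_total
  haveI : IsProper S.hom := IsSmoothProjective.isProper_holds hS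
  haveI : IsClosedImmersion t.left := CurveNet.isClosedImmersion_left_of_isSeparated t
  haveI : IsClosedImmersion e.left := isClosedImmersion_section_left hf he
  haveI : IsClosedImmersion (t ≫ e).left := by
    change IsClosedImmersion (t.left ≫ e.left)
    infer_instance
  rw [← LinearMap.comp_apply, ← complexGysin_comp hasPoincareDuality_complexOrientationFamily
    isSmoothProjective_specOver hS h𝒳 t e]
  let P : ComplexPoints (specOver ℂ ℂ) := 𝟙 _
  exact complexGysin_one_ne_zero_of_stalkMap_surjective complexOrientationFamily h𝒳 isSmoothProjective_specOver
    (t ≫ e) P ((t ≫ e).left.stalkMap_surjective P.pt) (e := d + 1) (by omega)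

/-- **The section class detects the fibre class: `[e(S)] ∪ [𝒳_t] ≠ 0` in `H^{2d+2}(𝒳(ℂ); ℂ)`** (`[e(S)] := e_* 1 ∈ H^{2d}`,
`[𝒳_t] = j_{t*} 1`). Indeed `[𝒳_t] = f^* σ` for some `σ ∈ H²(S(ℂ); ℂ)` (part XVI-c), necessarily `σ ≠ 0`; and
`f^* σ ∪ e_* 1 = e_*(e^* f^* σ ∪ 1) = e_* σ` (projection formula, `e ≫ f = 𝟙`), a non-zero multiple of `e_*[t] ≠ 0`.
[cite: FultonYoungTableaux1997, Appendix B §B.1 (6)] [cite: Fulton1998, §19.1 (proof of Prop. 19.1.1)] -/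
theorem cupProduct_sectionClass_fiberGysin_one_ne_zero {d : ℕ} {f : 𝒳 ⟶ S} (hf : IsCompactAbelianPencil f d)
    {e : S ⟶ 𝒳} (he : e ≫ f = 𝟙 S) (t : ComplexPoints S) :
    cupProduct (show 2 * d + 2 * (0 + 1) = 2 * (d + 1) by ring)
      (complexGysin complexOrientationFamily hf.isSmoothProjective_base hf.isSmoothProjective_total e
        (show 0 + 2 * (d + 1) = 2 * d + 2 * 1 by ring) (singularCohomology.one ℂ (ComplexPoints S)))
      (fiberGysin hf t 0 (singularCohomology.one ℂ (ComplexPoints (fiberOver f t)))) ≠ 0 := by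
  have hS := hf.isSmoothProjective_base
  have h𝒳 := hf.isSmoothProjective_total
  obtain ⟨σ, hσ⟩ := exists_fiberClass_eq_map_base hf t
  obtain ⟨c, hc⟩ := exists_eq_smul_pointGysin hS t σ
  have hσ0 : σ ≠ 0 := fun h0 ↦ fiberGysin_one_ne_zero hf t (by rw [hσ, h0, map_zero])
  have hc0 : c ≠ 0 := by
    rintro rfl
    exact hσ0 (by rw [hc, zero_smul])
  -- `[e(S)] ∪ f^*σ = f^*σ ∪ [e(S)] = e_*(e^* f^* σ ∪ 1) = e_* σ`
  have hproj := complexGysin_cup (μ := complexOrientationFamily) hasPoincareDuality_complexOrientationFamily hS h𝒳 e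
    (Nat.add_zero (2 * (0 + 1))) (show 2 * (0 + 1) + 2 * (d + 1) = 2 * (d + 1) + 2 * 1 by ring)
    (show 0 + 2 * (d + 1) = 2 * d + 2 * 1 by ring) (show 2 * (0 + 1) + 2 * d = 2 * (d + 1) by ring)
    (complexBetti.map f (2 * (0 + 1)) σ) (singularCohomology.one ℂ (ComplexPoints S))
  rw [cupProduct_one, ← CategoryTheory.comp_apply, ← complexBetti.map_comp, he, complexBetti.map_id,
    ModuleCat.id_apply] at hproj
  rw [hσ, cupProduct_gradedComm_holds ℂ (ComplexPoints 𝒳) (show 2 * d + 2 * (0 + 1) = 2 * (d + 1) by ring)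
    (show 2 * (0 + 1) + 2 * d = 2 * (d + 1) by ring), ← hproj, hc, map_smul, smul_ne_zero_iff, smul_ne_zero_iff]
  refine ⟨pow_ne_zero _ (by norm_num), hc0, complexGysin_section_pointGysin_ne_zero hf he t⟩

/-- **(Num_t) IN THE CORNER `(p, q) = (d, 0)` IS UNCONDITIONAL**: for every compact pencil of abelian `d`-folds, every `t`
and every `b ∈ N⁰(𝒳_t)` (`= H⁰(𝒳_t(ℂ); ℂ) = ℂ·1`): if `a ∪ j_{t*} b = 0` for all `a ∈ N^d(𝒳)`, then `j_{t*} b = 0` — because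
the algebraic class `e_* 1 ∈ N^d(𝒳)` of the zero section has `e_* 1 ∪ [𝒳_t] ≠ 0`. [cite: Kleiman1968AlgebraicCycles, §3 (D(X))]
[cite: Fulton1998, §19.1] -/
theorem numerical_top_zero' {d : ℕ} {f : 𝒳 ⟶ S} (hf : IsCompactAbelianPencil f d) (t : ComplexPoints S) :
    ∀ b ∈ algebraicClasses (fiberOver f t) 0,
      (∀ a ∈ algebraicClasses 𝒳 d,
        cupProduct (show 2 * d + 2 * (0 + 1) = 2 * (d + 1) by omega) a (fiberGysin hf t 0 b) = 0) →
        fiberGysin hf t 0 b = 0 := by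
  intro b _ hab
  have hS := hf.isSmoothProjective_base
  have h𝒳 := hf.isSmoothProjective_total
  obtain ⟨c, rfl⟩ := exists_eq_smul_one complexOrientationFamily (hf.isSmoothProjective_fiberOver t) b
  rcases eq_or_ne c 0 with rfl | hc
  · rw [zero_smul, map_zero]
  obtain ⟨e, he⟩ := hf.exists_section
  have haN : complexGysin complexOrientationFamily hS h𝒳 e (show 0 + 2 * (d + 1) = 2 * d + 2 * 1 by ring)
      (singularCohomology.one ℂ (ComplexPoints S)) ∈ algebraicClasses 𝒳 d := by
    have h := complexGysin_mem_algebraicClasses_of_mem_algebraicClasses (μ := complexOrientationFamily) hS h𝒳 e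
      (e' := 0) (e := d) (show 2 * 0 + 2 * (d + 1) = 2 * d + 2 * 1 by ring)
      (γ' := singularCohomology.one ℂ (ComplexPoints S)) (by rw [algebraicClasses_zero]; exact Submodule.mem_top)
    exact h
  have h1 := hab _ haN
  rw [map_smul, map_smul, smul_eq_zero] at h1
  rcases h1 with h1 | h1
  · exact absurd h1 hc
  · exact absurd h1 (cupProduct_sectionClass_fiberGysin_one_ne_zero hf he t)

end Summit.HodgeConjecture.HodgeConjecture.Ring2.AbelianAll

end
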